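import Literature.IUT.HodgeTheaters.FrobenioidBridgeModelsEx54viSchema
import Literature.IUT.HodgeTheaters.FrobenioidBridgeModelsEx54ivProofs
import HarnessLib

/-!
# [IUTchI] Example 5.4 (vi) (`S5Local.Ex54vi`) — INSTANCE FORMS at the tree's named §5-R4 stubs over converse data and
# over abc-iut-L5-t2's REAL initial Θ-data, the schema-level `iff`, and joint non-vacuity with `δ ≠ δ′`
# (cell abc-iut, seat abc-iut-f-169 gen 3, KEY row F2000 = FACT-LIST F-2000; PROOF-ONLY companion of
# `FrobenioidBridgeModels.lean`, abc-iut-L5-t3 p407134, node `IUTchI:Ex5.4(vi)`)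

S. Mochizuki, *Inter-universal Teichmüller theory I*, kurims manuscript (May 2020), Example 5.4 (vi), p. 149 l. −6 –
p. 150 l. 9 ([IUTchI] Ex 5.4 (vi) p.149): «any poly-morphism `†ℱ_⟨J⟩ → †ℱ^⊚` induces, via restriction, an isomorphism
class of functors `(†ℱ^⊚ → †ℱ^⊛ ⊇) †ℱ^⊛_mod ⥲ †ℱ^⊛_⟨J⟩ → †ℱ_{v⟨J⟩}` … which is independent of the choice of the
poly-morphism `†ℱ_⟨J⟩ → †ℱ^⊚` [i.e., among its `F_l^⋇`-conjugates]. That is to say, the fact that `†ℱ^⊛_mod` is defined in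
terms of terminal objects of `†𝒟^⊛` … implies that this particular isomorphism class of functors is immune to the various
indeterminacies» [claim: Mochizuki2012, status: disputed] (D-0012 claim key, series status DISPUTED — theorems about the
cell's OWN typing over the cell's OWN stubs; nothing of the series is asserted and no side is taken on [IUTchIII] Cor. 3.12).

## Standing of the row (FACT-LIST F-2000, label «universal-closure REFUTED / schema; instance forms BY NAME»)

abc-iut-L5-t3 renders (vi) over the hypothesis structure `S : S5Local 𝔡`, whose fields `RestrictionDatum` /
`restrictionOf` are BARE DATA, as `S5Local.Ex54vi S : ∀ Y Z d X δ δ′, S.restrictionOf d X δ = S.restrictionOf d X δ′`.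
Its universal closure is REFUTED and the statement is INDEPENDENT of the interface (abc-iut-w4-d071
`FrobenioidBridgeModelsEx54viSchema` p412217: `S5Local.not_forall_ex54vi`, `exists_s5Local_ex54vi`; abc-iut-w4-d067
`…Ex54viIndependence` p412310: holds on `toyS5Local`, fails on `toyS5LocalLab`).  What the row's label leaves open is the
INSTANCE FORM at the stubs the cone actually binds.  This file supplies it, BY NAME and with no new mathematics:

* §1 (every stub `S : S5Local 𝔡`, schema level): `FPolyHomNF.exists_ne` — the indeterminacy in the choice of
  `†ℱ_⟨J⟩ → †ℱ^⊚` is REAL as typed: there are always two distinct poly-morphisms (`l ≥ 5 ⇒ l^⋇ ≥ 2`, abc-iut-L5-t9's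
  `FPolyHomNF.card_eq`, ★ p510882); `ex54vi_iff_exists_const` — `Ex54vi S` holds IF AND ONLY IF every `S.restrictionOf d X`
  factors through a `δ`-free datum (print's stated REASON: the functors are built from `†ℱ^⊛_mod`, i.e. from terminal
  objects of `†𝒟^⊛`, not from `δ`; the `if` direction is w4-d071's `ex54vi_of_exists_const`);
* §2 (every converse datum `BaseThetaDatum.ofKitCore K hl5 hba hb N B E`, abc-iut-L5-t5 `KitS5LocalOfDatumNonVacuity` p442128):
  `S5Local.subsingleton_restrictionDatum_ofKitCore`, `S5Local.ex54vi_ofKitCore` — the generic KIT-RULE stub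
  `S5Local.ofKitCore … hval` takes `RestrictionDatum := PUnit`, so (vi) AS TYPED holds there by w4-d071's
  `ex54vi_of_subsingleton`;
* §3 (abc-iut-w5-d217's thickened datum, `FKitCoreBridgeWitness` p417964-lineage): `PMBaseKit.ex54vi_thickS5Local`;
* §4 (abc-iut-L5-t2's REAL `InitialThetaData`; abc-iut-w4-d054 `PiAvatarKitCoreThetaS5LocalWitness` ★ p497623): the stand-in
  datum `InitialThetaData.ex54vi_s5LocalThetaStandIn` and the §5-R4 STUB OF RECORD over the parametric bad-pair datum
  `InitialThetaData.ex54vi_s5LocalThetaOfBadPairs` — the very carrier at which abc-iut-L5-t9 fired Ex 5.4 (iv) (★ p510882 §6)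
  and at which abc-iut-w4-d054 decided `FKitCore` against the merge winner's genuine `ℱ`-kit (`GenuineFKitOfBadLocalFKitCore`);
* §5 JOINT NON-VACUITY at the stub of record WITH `δ ≠ δ′`: `InitialThetaData.exists_ne_restrictionOf_eq_s5LocalThetaOfBadPairs`
  — an isomorph `†ℱ^⊚`, an isomorph `†ℱ^⊛`, an arrow `†ℱ^⊚ ⇢ †ℱ^⊛`, an `ℱ`-prime-strip and TWO DISTINCT poly-morphisms
  `δ ≠ δ′ : †ℱ_⟨J⟩ → †ℱ^⊚` exist together and induce the same restriction datum; so the instance is not a statement about an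
  empty or one-element binder range.

## Binder census and HONEST LABELS (abc-iut-L5-lead RULINGS #110 (4) grammar)

§1: `𝔡`, `S` and DATA only — schema level, LAW 0 · FACT 0 · GAP 0.  §2: the kit binders {`K`, `hl5`, `hba`, `hb`, `N`, `B`, `E`}
and abc-iut-L5-t5's one named hypothesis `hval` («automorphisms of `𝒟^⊚` fix the distinguished valuations»; true by `rfl` at
the tree's degenerate NF kits, not a statement of print).  §3: {`K`, `hl5`, `hdis`, `hbad`}.  §4–§5: the displayed binders of
★ p497623 {`CG`, `hS`, `M`, `hA`, `hI`, `ES`} ∪ {`B`, `ΛBad`} (bad-pair DATA with LAWS), nothing else.  CARRIER LABEL, up front: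
at EVERY `S5Local` inhabitant of the tree (`toyS5Local`, `thickS5Local`, `S5Local.ofKitCore` and hence `s5LocalThetaStandIn` /
`s5LocalThetaOfBadPairs`) the restriction data are TRIVIAL (`RestrictionDatum := PUnit`, `restrictionOf := PUnit.unit`) — these
stubs are KIT-RULE consistency devices «`ℱ := 𝒟`, restriction data trivial» (labels of p442128 / ★ p497623 travel), so the
instances below hold because the carrier is a subsingleton, NOT because print's terminal-object argument has been formalised.
What remains for the node is exactly abc-iut-L5-t3's rider (STATUS 2026-08-27T03:08:38Z): a GENUINE `RestrictionDatum` carrier —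
the Example 5.1 (vii) restriction functors `(†ℱ^⊛_mod ⥲) †ℱ^⊛_⟨J⟩ → †ℱ_{v⟨J⟩}` of abc-iut-L5-t1's `GlobalFrobenioids*` glued into an
`S5Local` over the merge objects (m1)/(m4) — at which §1's `ex54vi_iff_exists_const` says precisely what has to be checked.
No token is claimed here.

PROOF-ONLY: no `def`, no `instance`, no notation, no `Prop` fact, no `sorry`; every `theorem` is a short application of landed
theorems; axioms ⊆ {propext, Classical.choice, Quot.sound}.  typed ≠ inhabited ≠ proved; refuted-as-typed ≠ refuted-in-print;
nothing here asserts that abc is proved or refuted.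
-/

namespace Literature.IUT.HodgeTheaters

open CategoryTheory

universe u v w

namespace BaseThetaDatum

/-! ### §1. Schema level (every stub `S : S5Local 𝔡`): the indeterminacy is real; (vi) ⟺ `restrictionOf` is `δ`-free -/

namespace S5Local

variable {𝔡 : BaseThetaDatum.{u}} {S : S5Local 𝔡}

/-- **The choice of `†ℱ_⟨J⟩ → †ℱ^⊚` is a genuine indeterminacy as typed**: between any `ℱ`-prime-strip `‡ℱ` and any
isomorph `†ℱ^⊚` there are two DISTINCT poly-morphisms `δ ≠ δ′` (there are exactly `l^⋇` of them, abc-iut-L5-t9's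
`FPolyHomNF.card_eq`, and `l ≥ 5` forces `l^⋇ ≥ 2`). ([IUTchI] Ex 5.4 (vi) p.149) [claim: Mochizuki2012, status: disputed] -/
theorem FPolyHomNF.exists_ne (X : S.FPrimeStrip) (Y : S.FAmbG) : ∃ δ δ' : FPolyHomNF S X Y, δ ≠ δ' := by
  have hc : Nat.card (FPolyHomNF S X Y) = lStar 𝔡.l := FPolyHomNF.card_eq X Y
  have h2 : 2 ≤ lStar 𝔡.l := two_le_lStar 𝔡.five_le_l
  haveI : Finite (FPolyHomNF S X Y) := Nat.finite_of_card_ne_zero (by omega)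
  exact (Finite.one_lt_card_iff_nontrivial.mp (by omega)).exists_pair_ne

variable (S) in
/-- **[IUTchI] Ex. 5.4 (vi) over a stub, as an `iff`**: the restriction data induced by the poly-morphisms
`†ℱ_⟨J⟩ → †ℱ^⊚` are independent of the choice of the poly-morphism IF AND ONLY IF each `S.restrictionOf d X` factors
through a datum not involving `δ` — print's stated reason («`†ℱ^⊛_mod` is defined in terms of terminal objects of `†𝒟^⊛`»)
is exactly the right-hand side; the `if` direction is abc-iut-w4-d071's `ex54vi_of_exists_const`, the `only if` direction
uses that poly-morphisms exist (`FPolyHomNF.nonempty`). ([IUTchI] Ex 5.4 (vi) p.149) [claim: Mochizuki2012, status: disputed] -/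
theorem ex54vi_iff_exists_const :
    Ex54vi S ↔ ∀ (Y : S.FAmbG) (Z : S.FAmbGlob) (d : S.DashArrow Y Z) (X : S.FPrimeStrip),
      ∃ r : S.RestrictionDatum Z X, ∀ δ : FPolyHomNF S X Y, S.restrictionOf d X δ = r := by
  refine ⟨fun h Y Z d X => ?_, ex54vi_of_exists_const S⟩
  obtain ⟨δ₀⟩ := FPolyHomNF.nonempty X Y
  exact ⟨S.restrictionOf d X δ₀, fun δ => h Y Z d X δ δ₀⟩

variable (S) in
/-- (vi) FAILS over a stub iff some arrow `†ℱ^⊚ ⇢ †ℱ^⊛`, some `ℱ`-prime-strip and two poly-morphisms `δ, δ′` induce DIFFERENT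
restriction data (the shape of every closure refuter of F-2000: `toyS5LocalLab`, `exists_s5Local_not_ex54vi`).
([IUTchI] Ex 5.4 (vi) p.149) [claim: Mochizuki2012, status: disputed] -/
theorem not_ex54vi_iff :
    ¬ Ex54vi S ↔ ∃ (Y : S.FAmbG) (Z : S.FAmbGlob) (d : S.DashArrow Y Z) (X : S.FPrimeStrip) (δ δ' : FPolyHomNF S X Y),
      S.restrictionOf d X δ ≠ S.restrictionOf d X δ' := by
  simp only [Ex54vi, not_forall]

end S5Local

/-! ### §2. The generic KIT-RULE stub over a converse datum: `S5Local.ofKitCore` (abc-iut-L5-t5, p442128) -/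

section OfKitCore

variable {l : ℕ} (K : PMBaseKit.{u} l) [Fact l.Prime] (hl5 : 5 ≤ l) (hba : ∀ x ∈ K.bad, x ∉ K.arc)
  (hb : K.bad.Nonempty) (N : K.NFKit) (B : K.MonoBinder) (E : K.EvalBinder)
  (hval : ∀ (b : N.gnfModel ≅ N.gnfModel) (x : K.V), N.valIso b (N.valOfV x) = N.valOfV x)

/-- **CARRIER LABEL in kernel form**: the restriction data of the generic converse-datum stub `S5Local.ofKitCore … hval` are
TRIVIAL — every type `RestrictionDatum Z X` is a subsingleton (it is `PUnit`; «restriction data trivial», p442128).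
([IUTchI] Ex 5.4 (vi) p.149) [claim: Mochizuki2012, status: disputed] -/
theorem S5Local.subsingleton_restrictionDatum_ofKitCore
    (Z : (S5Local.ofKitCore K hl5 hba hb N B E hval).FAmbGlob) (X : (S5Local.ofKitCore K hl5 hba hb N B E hval).FPrimeStrip) :
    Subsingleton ((S5Local.ofKitCore K hl5 hba hb N B E hval).RestrictionDatum Z X) := by
  change Subsingleton PUnit
  infer_instance

/-- **[IUTchI] Ex. 5.4 (vi) AS TYPED HOLDS at the generic converse-datum stub `S5Local.ofKitCore K hl5 hba hb N B E hval`** (every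
base kit `K`, NF kit `N`, binders `B`, `E`): abc-iut-w4-d071's `ex54vi_of_subsingleton` BY NAME, fed with the carrier label above.
Instance form of FACT-LIST row F-2000 at every converse datum; it holds because the carrier is trivial (honest label in the
module docstring), not by print's terminal-object argument. ([IUTchI] Ex 5.4 (vi) p.149) [claim: Mochizuki2012, status: disputed] -/
theorem S5Local.ex54vi_ofKitCore : S5Local.Ex54vi (S5Local.ofKitCore K hl5 hba hb N B E hval) :=
  S5Local.ex54vi_of_subsingleton _ (S5Local.subsingleton_restrictionDatum_ofKitCore K hl5 hba hb N B E hval)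

/-- At the generic converse-datum stub the `δ`-free factorisation of §1 is witnessed by the unique restriction datum.
([IUTchI] Ex 5.4 (vi) p.149) [claim: Mochizuki2012, status: disputed] -/
theorem S5Local.exists_const_restrictionOf_ofKitCore
    (Y : (S5Local.ofKitCore K hl5 hba hb N B E hval).FAmbG) (Z : (S5Local.ofKitCore K hl5 hba hb N B E hval).FAmbGlob)
    (d : (S5Local.ofKitCore K hl5 hba hb N B E hval).DashArrow Y Z) (X : (S5Local.ofKitCore K hl5 hba hb N B E hval).FPrimeStrip) :
    ∃ r : (S5Local.ofKitCore K hl5 hba hb N B E hval).RestrictionDatum Z X,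
      ∀ δ : S5Local.FPolyHomNF (S5Local.ofKitCore K hl5 hba hb N B E hval) X Y,
        (S5Local.ofKitCore K hl5 hba hb N B E hval).restrictionOf d X δ = r :=
  (S5Local.ex54vi_iff_exists_const _).1 (S5Local.ex54vi_ofKitCore K hl5 hba hb N B E hval) Y Z d X

end OfKitCore

end BaseThetaDatum

/-! ### §3. abc-iut-w5-d217's thickened datum: `PMBaseKit.thickS5Local` -/

namespace PMBaseKit

/-- **[IUTchI] Ex. 5.4 (vi) AS TYPED HOLDS at the thickened-datum stub `K.thickS5Local hl5 hdis hbad`** («restriction data trivial»,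
`FKitCoreBridgeWitness`; the binders are exactly those of `thickS5Local`): abc-iut-w4-d071's `ex54vi_of_subsingleton` BY NAME.
KIT-RULE stub; honest label as in §2. ([IUTchI] Ex 5.4 (vi) p.149) [claim: Mochizuki2012, status: disputed] -/
theorem ex54vi_thickS5Local {l : ℕ} (K : PMBaseKit.{0} l) [Fact l.Prime] (hl5 : 5 ≤ l) (hdis : Disjoint K.bad K.arc)
    (hbad : K.bad.Nonempty) : BaseThetaDatum.S5Local.Ex54vi (K.thickS5Local hl5 hdis hbad) :=
  BaseThetaDatum.S5Local.ex54vi_of_subsingleton _ fun _ _ => by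
    change Subsingleton PUnit
    infer_instance

end PMBaseKit

/-! ### §4. abc-iut-L5-t2's REAL initial Θ-data: the stand-in datum and the §5-R4 stub OF RECORD (★ p497623) -/

section StandIn

variable {F : Type u} {K : Type v} {Fbar : Type w} [Field F] [NumberField F] [Field K] [NumberField K]
  [Algebra F K] [Field Fbar] [Algebra F Fbar] [Algebra K Fbar]
  {E : WeierstrassCurve F} [E.IsElliptic] {l : ℕ} {Pb : BadPlacePredicates K}
  (D : InitialThetaData F K Fbar E l Pb) (CG : D.geom.pe.CuspGalois) (hS : D.CuspClassesNormaliserStable) [Fact l.Prime]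
  (M : D.TorsionMonodromy) (hA : D.geom.pe.ArrowCoveringClaims)
  (hI : ∀ k ∈ D.geom.pe.inertia D.geom.pe.ε1, M.tau (D.geom.embK k) = 0)

namespace InitialThetaData

variable {Gv : D.IndexCopy → Subgroup (Fbar ≃ₐ[F] Fbar)}
  (ES : ∀ v, v ∈ D.indexCopyBad → EvalSectionBinder (D.localDataStandIn CG hS M hA hI v) (Gv v))

/-- **[IUTchI] Ex. 5.4 (vi) AS TYPED HOLDS at the stand-in stub `D.s5LocalThetaStandIn CG hS M hA hI ES`** over the REAL initial
Θ-datum `D` (abc-iut-w4-d054 ★ p497623 §1; it IS `S5Local.ofKitCore` at the stand-in kits): §2 BY NAME.  KIT-RULE stub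
«`ℱ := 𝒟`, Θ-NF stand-in kit, restriction data trivial — labelled». ([IUTchI] Ex 5.4 (vi) p.149) [claim: Mochizuki2012, status: disputed] -/
theorem ex54vi_s5LocalThetaStandIn :
    BaseThetaDatum.S5Local.Ex54vi (D.s5LocalThetaStandIn CG hS M hA hI ES) :=
  BaseThetaDatum.S5Local.ex54vi_ofKitCore (D.baseKitThetaNFStandIn CG hS M hA hI) D.five_le_l
    (D.indexCopy_not_mem_arc_of_mem_bad) D.indexCopyBad_nonempty (D.nfKitThetaStandIn CG hS M hA hI)
    (PMBaseKit.MonoBinder.tautological _) (D.evalBinderThetaNFStandIn CG hS M hA hI D.five_le_l ES)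
    (D.nfKitThetaStandIn_valIso_valOfV CG hS M hA hI)

end InitialThetaData

end StandIn

section OfBadPairs

variable {F : Type u} {K : Type v} {Fbar : Type w} [Field F] [NumberField F] [Field K] [NumberField K]
  [Algebra F K] [Field Fbar] [Algebra F Fbar] [Algebra K Fbar]
  {E : WeierstrassCurve F} [E.IsElliptic] {l : ℕ} {Pb : BadPlacePredicates K}
  (D : InitialThetaData F K Fbar E l Pb) (CG : D.geom.pe.CuspGalois) (hS : D.CuspClassesNormaliserStable) [Fact l.Prime]
  (M : D.TorsionMonodromy) (hA : D.geom.pe.ArrowCoveringClaims)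
  (hI : ∀ k ∈ D.geom.pe.inertia D.geom.pe.ε1, M.tau (D.geom.embK k) = 0)
  (B : ∀ v, v ∈ D.indexCopyBad → D.BadPairAt v) (ΛBad : ∀ v (h : v ∈ D.indexCopyBad), D.LocalArrowLaw CG hS (B v h).H)

namespace InitialThetaData

variable {Gv : D.IndexCopy → Subgroup (Fbar ≃ₐ[F] Fbar)}
  (ES : ∀ v, v ∈ D.indexCopyBad → EvalSectionBinder (D.localDataOfBadPairs CG hS M hA hI B ΛBad v) (Gv v))

/-- **[IUTchI] Ex. 5.4 (vi) AS TYPED HOLDS at the §5-R4 STUB OF RECORD `D.s5LocalThetaOfBadPairs CG hS M hA hI B ΛBad ES`** over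
the REAL initial Θ-datum with parametric bad-pair data (abc-iut-w4-d054 ★ p497623 §3 — the carrier of abc-iut-L5-t9's Ex 5.4 (iv)
non-vacuity ★ p510882 and of the `FKITCORE-AT-GENUINE-FKIT` decision): §2 BY NAME.  Instance form of FACT-LIST row F-2000 at the
natural base's datum; KIT-RULE stub «`ℱ := 𝒟`, Θ-NF kit, bad-pair DATA `B`, restriction data trivial — labelled»; no token claim.
([IUTchI] Ex 5.4 (vi) p.149) [claim: Mochizuki2012, status: disputed] -/
theorem ex54vi_s5LocalThetaOfBadPairs :
    BaseThetaDatum.S5Local.Ex54vi (D.s5LocalThetaOfBadPairs CG hS M hA hI B ΛBad ES) :=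
  BaseThetaDatum.S5Local.ex54vi_ofKitCore (D.baseKitThetaNFOfBadPairs CG hS M hA hI B ΛBad) D.five_le_l
    (D.indexCopy_not_mem_arc_of_mem_bad) D.indexCopyBad_nonempty (D.nfKitThetaOfBadPairs CG hS M hA hI B ΛBad)
    (PMBaseKit.MonoBinder.tautological _) (D.evalBinderThetaNFOfBadPairs CG hS M hA hI B ΛBad D.five_le_l ES)
    (D.nfKitThetaOfBadPairs_valIso_valOfV CG hS M hA hI B ΛBad)

/-! ### §5. JOINT NON-VACUITY of the Ex 5.4 (vi) binders WITH `δ ≠ δ′` at the stub of record -/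

/-- **JOINT NON-VACUITY at the stub of record** `S := D.s5LocalThetaOfBadPairs … ES`: an isomorph `†ℱ^⊚`, an isomorph `†ℱ^⊛`,
an arrow `†ℱ^⊚ ⇢ †ℱ^⊛`, an `ℱ`-prime-strip `†ℱ_⟨J⟩` and TWO DISTINCT poly-morphisms `δ ≠ δ′ : †ℱ_⟨J⟩ → †ℱ^⊚` EXIST together and
induce the SAME restriction datum — the six binders of `Ex54vi` are jointly inhabited with a non-trivial indeterminacy
(`l^⋇ ≥ 2` choices, §1), so §4's instance quantifies over an inhabited, non-degenerate range.  Honest label: KIT-RULE stub,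
restriction data trivial. ([IUTchI] Ex 5.4 (vi) p.149) [claim: Mochizuki2012, status: disputed] -/
theorem exists_ne_restrictionOf_eq_s5LocalThetaOfBadPairs :
    ∃ (Y : (D.s5LocalThetaOfBadPairs CG hS M hA hI B ΛBad ES).FAmbG)
      (Z : (D.s5LocalThetaOfBadPairs CG hS M hA hI B ΛBad ES).FAmbGlob)
      (d : (D.s5LocalThetaOfBadPairs CG hS M hA hI B ΛBad ES).DashArrow Y Z)
      (X : (D.s5LocalThetaOfBadPairs CG hS M hA hI B ΛBad ES).FPrimeStrip)
      (δ δ' : BaseThetaDatum.S5Local.FPolyHomNF (D.s5LocalThetaOfBadPairs CG hS M hA hI B ΛBad ES) X Y),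
      δ ≠ δ' ∧
        (D.s5LocalThetaOfBadPairs CG hS M hA hI B ΛBad ES).restrictionOf d X δ =
          (D.s5LocalThetaOfBadPairs CG hS M hA hI B ΛBad ES).restrictionOf d X δ' := by
  set S := D.s5LocalThetaOfBadPairs CG hS M hA hI B ΛBad ES
  obtain ⟨δ, δ', hne⟩ := BaseThetaDatum.S5Local.FPolyHomNF.exists_ne (S := S) S.F S.FG
  exact ⟨S.FG, S.FGlob, S.dashModel, S.F, δ, δ', hne,
    D.ex54vi_s5LocalThetaOfBadPairs CG hS M hA hI B ΛBad ES S.FG S.FGlob S.dashModel S.F δ δ'⟩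

/-- At the stub of record there are exactly `l^⋇ ≥ 2` poly-morphisms `†ℱ_⟨J⟩ → †ℱ^⊚` and ALL of them induce one and the same
restriction datum: the `δ`-free factorisation of §1 holds (`l` = the prime of the REAL initial Θ-datum `D`).
([IUTchI] Ex 5.4 (vi) p.149) [claim: Mochizuki2012, status: disputed] -/
theorem exists_const_restrictionOf_s5LocalThetaOfBadPairs
    (Y : (D.s5LocalThetaOfBadPairs CG hS M hA hI B ΛBad ES).FAmbG)
    (Z : (D.s5LocalThetaOfBadPairs CG hS M hA hI B ΛBad ES).FAmbGlob)
    (d : (D.s5LocalThetaOfBadPairs CG hS M hA hI B ΛBad ES).DashArrow Y Z)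
    (X : (D.s5LocalThetaOfBadPairs CG hS M hA hI B ΛBad ES).FPrimeStrip) :
    Nat.card (BaseThetaDatum.S5Local.FPolyHomNF (D.s5LocalThetaOfBadPairs CG hS M hA hI B ΛBad ES) X Y) = lStar l ∧
      2 ≤ lStar l ∧
      ∃ r : (D.s5LocalThetaOfBadPairs CG hS M hA hI B ΛBad ES).RestrictionDatum Z X,
        ∀ δ : BaseThetaDatum.S5Local.FPolyHomNF (D.s5LocalThetaOfBadPairs CG hS M hA hI B ΛBad ES) X Y,
          (D.s5LocalThetaOfBadPairs CG hS M hA hI B ΛBad ES).restrictionOf d X δ = r :=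
  ⟨D.card_fPolyHomNF_s5LocalThetaOfBadPairs CG hS M hA hI B ΛBad ES X Y, two_le_lStar D.five_le_l,
    (BaseThetaDatum.S5Local.ex54vi_iff_exists_const _).1 (D.ex54vi_s5LocalThetaOfBadPairs CG hS M hA hI B ΛBad ES) Y Z d X⟩

end InitialThetaData

end OfBadPairs

end Literature.IUT.HodgeTheaters
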